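import Literature.NumberTheory.LFunctions.MatomakiRadziwillTaoTypical
import Literature.NumberTheory.Sieve.MatomakiRadziwill
import Mathlib.MeasureTheory.Function.Floor
import HarnessLib

/-!
# Matomäki–Radziwiłł–Tao 2015, Appendix A: the complex Matomäki–Radziwiłł theorem (named fact)

K. Matomäki, M. Radziwiłł, T. Tao, *An averaged form of Chowla's conjecture*, Algebra & Number
Theory **9** (2015), Appendix A, "Mean values of complex multiplicative functions in short
intervals" (journal pp. 2189–2192; arXiv:1503.05121, §6, where Theorem A.2 is Theorem 6.2).

* `Literature.MRT2015.shortSumA2 f I X h x` — `∑_{x ≤ n ≤ x + h, n ∈ 𝒮} f(n)` with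
  `𝒮 = {X ≤ n ≤ 2X : n ∈ I.Mem}` for an interval system `I : Parity.SieveIntervalSystem η X₀`
  (the tree's rendering of the systems `[P_j, Q_j]`, conditions (A-1), (A-2) and the cutoff
  `J` = largest `j` with `Q_j ≤ exp(√(log X₀))`, from `Sieve/MatomakiRadziwill.lean`, where it
  serves the real-valued original [MR2016, Theorem 3] = `Parity.MatomakiRadziwill2016_theorem3`);
* `Literature.NumberTheory.LFunctions.MatomakiRadziwillTao2015_theoremA2` — NAMED FACT, **Theorem A.2** as printed, over
  `I : Parity.SieveIntervalSystem η X₀` with `√X ≤ X₀ ≤ X`, the distance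
  `M(f; X) = Parity.minPretentiousDistSq f X X`;
* `Literature.NumberTheory.LFunctions.MRT2015.theoremA2_discrete` — PROVED corollary: the same bound for the discrete mean
  square `∑_{k} |∑_{k ≤ n < k + L, n ∈ 𝒮} f(n)|²` over integers `k ∈ (X + 1, 2X]`, obtained by
  taking `h = L - 1/2` and restricting the integral to the half-intervals `(k - 1/2, k)`, on which
  the window `[x, x + h] ∩ ℤ` is exactly `[k, k + L)`;
* `Literature.NumberTheory.LFunctions.MRT2015.mem_iff_forall_hasFactorIn`, `Literature.NumberTheory.LFunctions.MRT2015.mem_iff_isTypical` — PROVED bridges: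
  `I.Mem n` is "a prime factor in each `[P_j, Q_j]` with `Q_j ≤ exp(√(log X₀))`", and for a system
  with the endpoints of Definition 2.1 it is `Literature.MRT2015.IsTypical P₁ Q₁ X₀ n`;
* `Literature.NumberTheory.LFunctions.MRT2015.def21_system` — PROVED: the sequence of Definition 2.1 IS such a system
  (monotonicity, (A-1), (A-2), existence of `J`) as soon as
  `exp(√(log X₀)) ≥ Q₁ ≥ P₁ ≥ (log Q₁)^{40/η}` and `P₁` is large in terms of `η` ("For example, …
  can be verified to obey the above estimates", App. A).

## References
* [MRT2015] Matomäki–Radziwiłł–Tao, Algebra & Number Theory 9 (2015), 2167–2196: (1-6),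
  Definition 2.1, Appendix A (conditions (A-1), (A-2), Theorem A.2, p. 2190).
  [cite: MatomakiRadziwillTao2015, Appendix A, Theorem A.2]
* [MR2016] K. Matomäki, M. Radziwiłł, *Multiplicative functions in short intervals*, Ann. of
  Math. 183 (2016), §2 and Theorem 3 (the real-valued original; tree:
  `Literature/NumberTheory/Sieve/MatomakiRadziwill.lean`).

## Design choices
* `f` is an `ArithmeticFunction ℂ` with `IsMultiplicative` and `‖f n‖ ≤ 1` ("`1`-bounded
  multiplicative"), as in `Literature.NumberTheory.LFunctions.MatomakiRadziwillTao2015_theorem17`.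
* The interval system, (A-1) (denominator cleared, the intended reading), (A-2), `1 ≤ P₁` and the
  cutoff `J` are the tree's `Parity.SieveIntervalSystem η X₀` — conditions (2), (3) of [MR2016, §2]
  are verbatim (A-1), (A-2), and its level parameter is Appendix A's `X₀` — so that this fact and
  `Parity.MatomakiRadziwill2016_theorem3` quantify over the same objects; `n ∈ 𝒮` is
  `X ≤ n ≤ 2X ∧ I.Mem n`.
* `M(f; X) = inf_{|t| ≤ X} 𝔻(f, n^{it}; X)²` ([MRT2015, (1-6)]) is the tree's
  `Parity.minPretentiousDistSq f X X`.
* "`≪`": a constant `C` that may depend on `η` (weaker than an absolute constant); "for all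
  `X > X(η)` large enough and all `h ≥ 3`" (p. 2190) verbatim.
* The first error term is vendored in Halász's form `(1 + M) e^{-M}` (see the docstring of the
  fact for why the literal `e^{-M} M` cannot be meant).
* The integral `(1/X) ∫_X^{2X} |h⁻¹ ∑ …|² dx` is Mathlib's interval integral.
-/

noncomputable section

open Finset Real MeasureTheory
open scoped Classical

namespace Literature.NumberTheory.LFunctions

open Sieve (SieveIntervalSystem minPretentiousDistSq minPretentiousDistSq_nonneg)

namespace MRT2015

/-! ### The restricted short sums -/

variable {η X₀ : ℝ}

/-- `∑_{a ≤ n ≤ b, n ∈ 𝒮} f(n)` with `𝒮 = {X ≤ n ≤ 2X : n ∈ I.Mem}` (integer endpoints `a, b`).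
[cite: MatomakiRadziwillTao2015, Theorem A.2] -/
def restrSum (f : ℕ → ℂ) (I : SieveIntervalSystem η X₀) (X : ℝ) (a b : ℕ) : ℂ :=
  ∑ n ∈ (Icc a b).filter (fun n : ℕ => X ≤ n ∧ (n : ℝ) ≤ 2 * X ∧ I.Mem n), f n

/-- The restricted short sum `∑_{x ≤ n ≤ x + h, n ∈ 𝒮} f(n)` of Theorem A.2, with
`𝒮 = {X ≤ n ≤ 2X : n ∈ I.Mem}` (integers `n` of the real window `[x, x + h]`).
[cite: MatomakiRadziwillTao2015, Theorem A.2] -/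
def shortSumA2 (f : ℕ → ℂ) (I : SieveIntervalSystem η X₀) (X h x : ℝ) : ℂ :=
  restrSum f I X ⌈x⌉₊ ⌊x + h⌋₊

end MRT2015

open MRT2015 in
/-- NAMED FACT — **Matomäki–Radziwiłł–Tao 2015, Theorem A.2** (Algebra & Number Theory 9 (2015),
Appendix A, p. 2190), with the standing assumptions of Appendix A: "Let `η ∈ (0, 1/6)`, and let
`X₀` be a quantity with `√X ≤ X₀ ≤ X`. Consider a sequence of increasing intervals `[P_j, Q_j]`,
`j ≥ 1`, such that `Q₁ ≤ exp(√(log X₀))`; (A-1) for all `j ≥ 2`,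
`log log Q_j / (log P_{j-1} - 1) ≤ η/(4j²)`; (A-2) for all `j ≥ 2`,
`(η/j²) log P_j ≥ 8 log Q_{j-1} + 16 log j`. Let `𝒮` be the set of integers `X ≤ n ≤ 2X` having
at least one prime factor in each of the intervals `[P_j, Q_j]` for `j ≤ J`, where `J` is the
largest index with `Q_J ≤ exp((log X₀)^{1/2})`. **Theorem A.2.** Let `f` be a `1`-bounded
multiplicative function. Let `𝒮` be as above with `η ∈ (0, 1/6)`. If `[P₁, Q₁] ⊂ [1, h]`, then
for all `X > X(η)` large enough and `h ≥ 3`,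
`(1/X) ∫_X^{2X} |h⁻¹ ∑_{x ≤ n ≤ x+h, n ∈ 𝒮} f(n)|² dx
   ≪ exp(-M(f;X)) M(f;X) + (log h)^{1/3} / P₁^{1/6-η} + 1/(log X)^{1/50}`."
(The proof "proceeds as the proof of [Matomäki–Radziwiłł 2015, Theorem 3]".)  Rendering: the
interval system with (A-1), (A-2), `P₁ ≥ 1` and the cutoff `J` is `I : Parity.SieveIntervalSystem η X₀`
(the structure used for the real-valued original `Parity.MatomakiRadziwill2016_theorem3`), `n ∈ 𝒮`
is `X ≤ n ≤ 2X ∧ I.Mem n` (`shortSumA2`), `Q₁ ≤ h` is `[P₁, Q₁] ⊂ [1, h]`, and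
`M(f; X) = inf_{|t| ≤ X} 𝔻(f, n^{it}; X)²` ((1-6)) is `Parity.minPretentiousDistSq f X X`.  The
implied constant is allowed to depend on `η`.

**Reading of the first error term.** Literally, `exp(-M) M` vanishes when `M(f; X) = 0` (e.g.
`f = 1`, `t = 0`), and then the printed bound is false (take `f = 1`, `X₀ = X`,
`Q₁ = h = exp((log X)^{1/4})`, `P₁ = (log Q₁)^{480}` as in the paper's own proof of Theorem A.1:
`𝒮` has density `→ 1` by Lemma 2.2, so the left side is `≥ 1/4` while the right side `→ 0`).  The
printed term is the usual shorthand for Halász's `(1 + M) e^{-M}` — the proof of Proposition A.3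
begins "we can assume … `M(f;X) ≥ 1`", the range `M < 1` being covered by the trivial bound — and
we vendor it in that form, `(1 + M(f;X)) exp(-M(f;X))`, which dominates the printed
`exp(-M) M`; the statement below is therefore implied by (a correct reading of) the printed one
(cf. the same remark on `M e^{-M}` in the docstring of `Parity.halaszMontgomeryTenenbaum`).
Users take `(h : MatomakiRadziwillTao2015_theoremA2)`.
[cite: MatomakiRadziwillTao2015, Appendix A, Theorem A.2] -/
def MatomakiRadziwillTao2015_theoremA2 : Prop :=
  ∀ η : ℝ, 0 < η → η < 1 / 6 → ∃ C Xη : ℝ, ∀ (X X₀ h : ℝ) (I : SieveIntervalSystem η X₀)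
    (f : ArithmeticFunction ℂ), f.IsMultiplicative → (∀ n, ‖f n‖ ≤ 1) →
    Xη < X → 3 ≤ h → Real.sqrt X ≤ X₀ → X₀ ≤ X → I.Q 1 ≤ h →
    1 / X * ∫ x in X..(2 * X), ‖(h : ℂ)⁻¹ * MRT2015.shortSumA2 f I X h x‖ ^ 2 ≤
      C * ((1 + minPretentiousDistSq f X X) * Real.exp (-minPretentiousDistSq f X X) +
        Real.log h ^ (1 / 3 : ℝ) / (I.P 1) ^ (1 / 6 - η) + 1 / Real.log X ^ (1 / 50 : ℝ))

namespace MRT2015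

/-! ### The discrete corollary -/

variable {η X₀ : ℝ}

/-- On the half-interval `(k - 1/2, k)` (`k ≥ 1`) the integer points of `[x, x + (L - 1/2)]` are
exactly `k, …, k + L - 1` (`L ≥ 1`). [folklore] -/
theorem Icc_ceil_floor_eq_Ico {k L : ℕ} (hk : 1 ≤ k) (hL : 1 ≤ L) {x : ℝ}
    (hx : x ∈ Set.Ioo ((k : ℝ) - 1 / 2) k) :
    Icc ⌈x⌉₊ ⌊x + ((L : ℝ) - 1 / 2)⌋₊ = Ico k (k + L) := by
  obtain ⟨hx1, hx2⟩ := hx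
  have hk' : ((k - 1 : ℕ) : ℝ) = (k : ℝ) - 1 := by
    rw [Nat.cast_sub hk]; simp
  have hceil : ⌈x⌉₊ = k := by
    rw [Nat.ceil_eq_iff (by omega)]
    refine ⟨?_, hx2.le⟩
    rw [hk']; linarith
  have hfloor : ⌊x + ((L : ℝ) - 1 / 2)⌋₊ = k + L - 1 := by
    rw [Nat.floor_eq_iff (by linarith)]
    have e : ((k + L - 1 : ℕ) : ℝ) = (k : ℝ) + L - 1 := by
      rw [Nat.cast_sub (by omega)]; push_cast; ring
    rw [e]
    constructor <;> linarith
  rw [hceil, hfloor]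
  ext n; simp only [Finset.mem_Icc, Finset.mem_Ico]; omega

/-- The squared short sum as a function of `x` (the integrand of Theorem A.2 without the factor
`h⁻²`). [cite: MatomakiRadziwillTao2015, Theorem A.2] -/
def sqIntegrand (f : ℕ → ℂ) (I : SieveIntervalSystem η X₀) (X h : ℝ) (x : ℝ) : ℝ :=
  ‖shortSumA2 f I X h x‖ ^ 2

/-- The integrand is measurable (a function of `(⌈x⌉, ⌊x + h⌋)`). [folklore] -/
theorem measurable_sqIntegrand (f : ℕ → ℂ) (I : SieveIntervalSystem η X₀) (X h : ℝ) :
    Measurable (sqIntegrand f I X h) := by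
  have h1 : Measurable fun x : ℝ => (⌈x⌉₊, ⌊x + h⌋₊) :=
    Nat.measurable_ceil.prodMk (Nat.measurable_floor.comp (measurable_id.add_const _))
  have e : sqIntegrand f I X h = fun x : ℝ =>
      ‖(Function.uncurry (restrSum f I X) ∘ (fun x : ℝ => (⌈x⌉₊, ⌊x + h⌋₊))) x‖ ^ 2 := by
    funext x
    simp only [sqIntegrand, shortSumA2, Function.comp_apply, Function.uncurry_apply_pair]
  rw [e]
  exact ((measurable_of_countable (Function.uncurry (restrSum f I X))).comp h1).norm.pow_const 2

/-- The integrand is nonnegative. [folklore] -/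
theorem sqIntegrand_nonneg (f : ℕ → ℂ) (I : SieveIntervalSystem η X₀) (X h x : ℝ) :
    0 ≤ sqIntegrand f I X h x := by
  unfold sqIntegrand; positivity

/-- The integrand is at most `(h + 2)²` for `1`-bounded `f`. [folklore] -/
theorem sqIntegrand_le {f : ℕ → ℂ} (hf : ∀ n, ‖f n‖ ≤ 1) (I : SieveIntervalSystem η X₀) (X : ℝ) {h : ℝ}
    (hh : 0 ≤ h) (x : ℝ) : sqIntegrand f I X h x ≤ (h + 2) ^ 2 := by
  unfold sqIntegrand shortSumA2 restrSum
  have hcard : (#((Icc ⌈x⌉₊ ⌊x + h⌋₊).filter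
      (fun n : ℕ => X ≤ n ∧ (n : ℝ) ≤ 2 * X ∧ I.Mem n)) : ℝ) ≤ h + 2 := by
    calc (#((Icc ⌈x⌉₊ ⌊x + h⌋₊).filter
        (fun n : ℕ => X ≤ n ∧ (n : ℝ) ≤ 2 * X ∧ I.Mem n)) : ℝ)
        ≤ #(Icc ⌈x⌉₊ ⌊x + h⌋₊) := by exact_mod_cast Finset.card_filter_le _ _
      _ = ((⌊x + h⌋₊ + 1 - ⌈x⌉₊ : ℕ) : ℝ) := by rw [Nat.card_Icc]
      _ ≤ h + 2 := by
          have h1 : ⌊x + h⌋₊ + 1 - ⌈x⌉₊ ≤ ⌊h⌋₊ + 2 := by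
            rcases lt_or_ge (x + h) 0 with hneg | hpos
            · rw [Nat.floor_of_nonpos hneg.le]; omega
            · have : ((⌊x + h⌋₊ : ℕ) : ℝ) < ⌈x⌉₊ + (⌊h⌋₊ + 1) := by
                calc ((⌊x + h⌋₊ : ℕ) : ℝ) ≤ x + h := Nat.floor_le hpos
                  _ < ⌈x⌉₊ + (⌊h⌋₊ + 1) := by linarith [Nat.le_ceil x, Nat.lt_floor_add_one h]
              have : ⌊x + h⌋₊ < ⌈x⌉₊ + (⌊h⌋₊ + 1) := by exact_mod_cast this
              omega
          calc ((⌊x + h⌋₊ + 1 - ⌈x⌉₊ : ℕ) : ℝ) ≤ ((⌊h⌋₊ + 2 : ℕ) : ℝ) := by exact_mod_cast h1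
            _ = (⌊h⌋₊ : ℝ) + 2 := by push_cast; ring
            _ ≤ h + 2 := by linarith [Nat.floor_le hh]
  have hnorm : ‖∑ n ∈ (Icc ⌈x⌉₊ ⌊x + h⌋₊).filter
      (fun n : ℕ => X ≤ n ∧ (n : ℝ) ≤ 2 * X ∧ I.Mem n), f n‖ ≤ h + 2 := by
    refine (norm_sum_le _ _).trans ?_
    refine le_trans (Finset.sum_le_sum fun n _ => hf n) ?_
    simpa using hcard
  calc ‖∑ n ∈ (Icc ⌈x⌉₊ ⌊x + h⌋₊).filter
        (fun n : ℕ => X ≤ n ∧ (n : ℝ) ≤ 2 * X ∧ I.Mem n), f n‖ ^ 2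
      ≤ (h + 2) ^ 2 := pow_le_pow_left₀ (norm_nonneg _) hnorm 2

/-- The integrand is integrable on bounded intervals. [folklore] -/
theorem intervalIntegrable_sqIntegrand {f : ℕ → ℂ} (hf : ∀ n, ‖f n‖ ≤ 1)
    (I : SieveIntervalSystem η X₀) (X : ℝ) {h : ℝ} (hh : 0 ≤ h) (a b : ℝ) :
    IntervalIntegrable (sqIntegrand f I X h) volume a b := by
  refine IntegrableOn.intervalIntegrable ?_
  refine Measure.integrableOn_of_bounded (M := (h + 2) ^ 2) ?_
    (measurable_sqIntegrand f I X h).aestronglyMeasurable ?_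
  · rw [Set.uIcc, Real.volume_Icc]; exact ENNReal.ofReal_ne_top
  · exact Filter.Eventually.of_forall fun y => by
      rw [Real.norm_eq_abs, abs_of_nonneg (sqIntegrand_nonneg f I X h y)]
      exact sqIntegrand_le hf I X hh y

/-- The discrete window sum attached to the integer `k`: `∑_{k ≤ n < k+L, n ∈ 𝒮} f(n)`.
[cite: MatomakiRadziwillTao2015, Theorem A.2] -/
def windowSumA2 (f : ℕ → ℂ) (I : SieveIntervalSystem η X₀) (X : ℝ) (L k : ℕ) : ℂ :=
  ∑ n ∈ (Ico k (k + L)).filter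
    (fun n : ℕ => X ≤ n ∧ (n : ℝ) ≤ 2 * X ∧ I.Mem n), f n

/-- `∫_{k-1/2}^{k} |∑_{[x,x+L-1/2]}|² dx = (1/2) |∑_{[k, k+L)}|²`. [folklore] -/
theorem integral_sqIntegrand_half (f : ℕ → ℂ) (I : SieveIntervalSystem η X₀) (X : ℝ) {k L : ℕ}
    (hk : 1 ≤ k)
    (hL : 1 ≤ L) :
    ∫ x in ((k : ℝ) - 1 / 2)..k, sqIntegrand f I X ((L : ℝ) - 1 / 2) x =
      1 / 2 * ‖windowSumA2 f I X L k‖ ^ 2 := by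
  rw [intervalIntegral.integral_of_le (by linarith), ← setIntegral_congr_set Ioo_ae_eq_Ioc,
    setIntegral_congr_fun measurableSet_Ioo (g := fun _ => ‖windowSumA2 f I X L k‖ ^ 2)
      (fun x hx => by
        simp only [sqIntegrand, shortSumA2, restrSum, windowSumA2]
        rw [Icc_ceil_floor_eq_Ico hk hL hx]),
    setIntegral_const, Real.volume_real_Ioo_of_le (by linarith)]
  simp only [smul_eq_mul]
  ring

/-- `∑_{k = K₁}^{K₂} (1/2)|∑_{[k,k+L)}|² ≤ ∫_{K₁ - 1}^{K₂} |∑_{[x, x+L-1/2]}|² dx` for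
`1 ≤ K₁`. [folklore] -/
theorem sum_half_sq_le_integral {f : ℕ → ℂ} (hf : ∀ n, ‖f n‖ ≤ 1) (I : SieveIntervalSystem η X₀)
    (X : ℝ) {K₁ K₂ L : ℕ} (hK : 1 ≤ K₁) (hK₂ : K₁ ≤ K₂ + 1) (hL : 1 ≤ L) :
    ∑ k ∈ Icc K₁ K₂, 1 / 2 * ‖windowSumA2 f I X L k‖ ^ 2 ≤
      ∫ x in ((K₁ : ℝ) - 1)..K₂, sqIntegrand f I X ((L : ℝ) - 1 / 2) x := by
  have hh : (0 : ℝ) ≤ (L : ℝ) - 1 / 2 := by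
    have : (1 : ℝ) ≤ L := by exact_mod_cast hL
    linarith
  -- split the integral at the integers
  have hadj := intervalIntegral.sum_integral_adjacent_intervals
    (f := sqIntegrand f I X ((L : ℝ) - 1 / 2)) (μ := volume)
    (a := fun i : ℕ => ((K₁ - 1 + i : ℕ) : ℝ)) (n := K₂ + 1 - K₁)
    (fun i _ => intervalIntegrable_sqIntegrand hf I X hh _ _)
  have e1 : ((K₁ - 1 + 0 : ℕ) : ℝ) = (K₁ : ℝ) - 1 := by
    rw [Nat.add_zero, Nat.cast_sub hK]; simp
  have e2 : ((K₁ - 1 + (K₂ + 1 - K₁) : ℕ) : ℝ) = K₂ := by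
    rw [show K₁ - 1 + (K₂ + 1 - K₁) = K₂ by omega]
  rw [e1, e2] at hadj
  rw [← hadj]
  -- compare term by term
  have hIcc : Icc K₁ K₂ = (range (K₂ + 1 - K₁)).image (fun i => K₁ + i) := by
    ext k
    simp only [Finset.mem_Icc, Finset.mem_image, Finset.mem_range]
    constructor
    · intro h; exact ⟨k - K₁, by omega, by omega⟩
    · rintro ⟨i, hi, rfl⟩; omega
  rw [hIcc, Finset.sum_image (fun i _ j _ h => by omega)]
  refine Finset.sum_le_sum fun i hi => ?_
  have e3 : ((K₁ - 1 + i : ℕ) : ℝ) = ((K₁ + i : ℕ) : ℝ) - 1 := by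
    rw [Nat.cast_add, Nat.cast_sub hK]; push_cast; ring
  have e4 : ((K₁ - 1 + (i + 1) : ℕ) : ℝ) = ((K₁ + i : ℕ) : ℝ) := by
    rw [show K₁ - 1 + (i + 1) = K₁ + i by omega]
  rw [e3, e4, ← integral_sqIntegrand_half f I X (k := K₁ + i) (by omega) hL]
  -- `∫_{k-1/2}^k ≤ ∫_{k-1}^k` for a nonnegative integrand
  exact intervalIntegral.integral_mono_interval (by linarith) (by linarith) le_rfl
    (Filter.Eventually.of_forall fun y => sqIntegrand_nonneg f I X _ y)
    (intervalIntegrable_sqIntegrand hf I X hh _ _)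

/-- **Discrete corollary of Theorem A.2** (PROVED from the named fact): under the hypotheses of
Theorem A.2 with `h = L - 1/2` (`L ≥ 4` an integer, `Q₁ ≤ L - 1/2`), the discrete mean square
over the integer windows `[k, k + L)`, `k ∈ [⌈X⌉ + 1, ⌊2X⌋]`, obeys
`∑_k |∑_{k ≤ n < k+L, n ∈ 𝒮} f(n)|² ≤ 2 C ((1+M)e^{-M} + (log L)^{1/3}/P₁^{1/6-η} + (log X)^{-1/50}) L² X`:
on `x ∈ (k - 1/2, k)` the real window `[x, x + h]` has integer points `[k, k + L)`, so the sum is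
at most `2 ∫_X^{2X} |∑|² dx`. [cite: MatomakiRadziwillTao2015, Appendix A, Theorem A.2] -/
theorem theoremA2_discrete (hA2 : MatomakiRadziwillTao2015_theoremA2) :
    ∀ η : ℝ, 0 < η → η < 1 / 6 → ∃ C Xη : ℝ, 0 ≤ C ∧ ∀ (X X₀ : ℝ) (L : ℕ)
      (I : SieveIntervalSystem η X₀) (f : ArithmeticFunction ℂ),
      f.IsMultiplicative → (∀ n, ‖f n‖ ≤ 1) →
      Xη < X → 4 ≤ L → Real.sqrt X ≤ X₀ → X₀ ≤ X → I.Q 1 ≤ (L : ℝ) - 1 / 2 →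
      ∑ k ∈ Icc (⌈X⌉₊ + 1) ⌊2 * X⌋₊, ‖windowSumA2 f I X L k‖ ^ 2 ≤
        2 * C * ((1 + minPretentiousDistSq f X X) * Real.exp (-minPretentiousDistSq f X X) +
          Real.log L ^ (1 / 3 : ℝ) / (I.P 1) ^ (1 / 6 - η) + 1 / Real.log X ^ (1 / 50 : ℝ)) *
          (L : ℝ) ^ 2 * X := by
  intro η hη hη'
  obtain ⟨C, Xη, hC⟩ := hA2 η hη hη'
  refine ⟨max C 0, max Xη 1, le_max_right _ _, ?_⟩
  intro X X₀ L I f hf hf1 hX hL hX₀ hX₀X hQL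
  have hP1 : 1 ≤ I.P 1 := I.one_le_P_one
  have hX1 : 1 < X := lt_of_le_of_lt (le_max_right _ _) hX
  have hXη : Xη < X := lt_of_le_of_lt (le_max_left _ _) hX
  have hX0 : 0 < X := by linarith
  set h : ℝ := (L : ℝ) - 1 / 2 with hhdef
  have hL4 : (4 : ℝ) ≤ L := by exact_mod_cast hL
  have hh3 : 3 ≤ h := by rw [hhdef]; linarith
  have hh0 : 0 < h := by linarith
  have key := hC X X₀ h I f hf hf1 hXη hh3 hX₀ hX₀X hQL
  -- the error factor
  set B : ℝ := (1 + minPretentiousDistSq f X X) * Real.exp (-minPretentiousDistSq f X X) + Real.log h ^ (1 / 3 : ℝ) / (I.P 1) ^ (1 / 6 - η) +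
    1 / Real.log X ^ (1 / 50 : ℝ) with hB
  set B' : ℝ := (1 + minPretentiousDistSq f X X) * Real.exp (-minPretentiousDistSq f X X) + Real.log L ^ (1 / 3 : ℝ) / (I.P 1) ^ (1 / 6 - η) +
    1 / Real.log X ^ (1 / 50 : ℝ) with hB'
  have hBB' : B ≤ B' := by
    rw [hB, hB']
    have h1 : Real.log h ^ (1 / 3 : ℝ) ≤ Real.log L ^ (1 / 3 : ℝ) :=
      Real.rpow_le_rpow (Real.log_nonneg (by linarith)) (Real.log_le_log hh0 (by rw [hhdef]; linarith))
        (by norm_num)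
    have hc : 0 < (I.P 1) ^ (1 / 6 - η) := Real.rpow_pos_of_pos (by linarith) _
    have h2 := div_le_div_of_nonneg_right h1 hc.le
    linarith
  -- `B ≥ 0`
  have hBpos : 0 ≤ B := by
    rw [hB]
    have h1 : 0 ≤ (1 + minPretentiousDistSq f X X) * Real.exp (-minPretentiousDistSq f X X) := by
      have := minPretentiousDistSq_nonneg hf1 X hX0.le
      positivity
    have h2 : 0 ≤ Real.log h ^ (1 / 3 : ℝ) / (I.P 1) ^ (1 / 6 - η) :=
      div_nonneg (Real.rpow_nonneg (Real.log_nonneg (by linarith)) _) (Real.rpow_nonneg (by linarith) _)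
    have h3 : 0 ≤ 1 / Real.log X ^ (1 / 50 : ℝ) := by
      have := Real.rpow_nonneg (Real.log_nonneg hX1.le) (1 / 50 : ℝ)
      positivity
    linarith
  -- rewrite the integrand: `‖h⁻¹ S‖² = h⁻² ‖S‖²`
  have hpt : ∀ x, ‖(h : ℂ)⁻¹ * shortSumA2 f I X h x‖ ^ 2 =
      (1 / h ^ 2) * sqIntegrand f I X h x := by
    intro x
    rw [sqIntegrand, norm_mul, norm_inv, Complex.norm_real, Real.norm_eq_abs, abs_of_pos hh0,
      mul_pow, inv_pow, one_div]
  have hint : ∫ x in X..(2 * X), ‖(h : ℂ)⁻¹ * shortSumA2 f I X h x‖ ^ 2 =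
      (1 / h ^ 2) * ∫ x in X..(2 * X), sqIntegrand f I X h x := by
    rw [← intervalIntegral.integral_const_mul]
    exact intervalIntegral.integral_congr fun x _ => hpt x
  rw [hint] at key
  -- so `∫ sqIntegrand ≤ C B h² X`
  have hI0 : 0 ≤ ∫ x in X..(2 * X), sqIntegrand f I X h x :=
    intervalIntegral.integral_nonneg (by linarith) fun x _ => sqIntegrand_nonneg f I X h x
  have hint2 : ∫ x in X..(2 * X), sqIntegrand f I X h x ≤ max C 0 * B' * h ^ 2 * X := by
    have h1 : 1 / X * (1 / h ^ 2 * ∫ x in X..(2 * X), sqIntegrand f I X h x) ≤ max C 0 * B' :=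
      calc _ ≤ C * B := key
        _ ≤ max C 0 * B := mul_le_mul_of_nonneg_right (le_max_left _ _) hBpos
        _ ≤ max C 0 * B' := mul_le_mul_of_nonneg_left hBB' (le_max_right _ _)
    have h2 : 1 / X * (1 / h ^ 2 * ∫ x in X..(2 * X), sqIntegrand f I X h x) =
        (∫ x in X..(2 * X), sqIntegrand f I X h x) / (X * h ^ 2) := by
      field_simp
    rw [h2, div_le_iff₀ (by positivity)] at h1
    linarith
  -- the discrete sum is at most twice the integral over `[⌈X⌉, ⌊2X⌋] ⊆ [X, 2X]`
  have hK₁ : 1 ≤ ⌈X⌉₊ + 1 := by omega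
  have hceil : ⌈X⌉₊ ≤ ⌊2 * X⌋₊ :=
    Nat.le_floor (by linarith [Nat.ceil_lt_add_one hX0.le])
  have hsum := sum_half_sq_le_integral hf1 I X (K₁ := ⌈X⌉₊ + 1) (K₂ := ⌊2 * X⌋₊) (L := L)
    hK₁ (by omega) (by omega)
  have hsub : ∫ x in (((⌈X⌉₊ + 1 : ℕ) : ℝ) - 1)..(⌊2 * X⌋₊ : ℕ), sqIntegrand f I X h x ≤
      ∫ x in X..(2 * X), sqIntegrand f I X h x := by
    have h1 : X ≤ ((⌈X⌉₊ + 1 : ℕ) : ℝ) - 1 := by push_cast; linarith [Nat.le_ceil X]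
    have h2 : ((⌊2 * X⌋₊ : ℕ) : ℝ) ≤ 2 * X := Nat.floor_le (by linarith)
    have h3 : ((⌈X⌉₊ + 1 : ℕ) : ℝ) - 1 ≤ ((⌊2 * X⌋₊ : ℕ) : ℝ) ∨ ((⌊2 * X⌋₊ : ℕ) : ℝ) < ((⌈X⌉₊ + 1 : ℕ) : ℝ) - 1 :=
      le_or_gt _ _
    rcases h3 with h3 | h3
    · exact intervalIntegral.integral_mono_interval h1 h3 h2
        (Filter.Eventually.of_forall fun y => sqIntegrand_nonneg f I X h y)
        (intervalIntegrable_sqIntegrand hf1 I X hh0.le _ _)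
    · rw [intervalIntegral.integral_of_ge h3.le]
      have : 0 ≤ ∫ x in Set.Ioc (((⌊2 * X⌋₊ : ℕ) : ℝ)) (((⌈X⌉₊ + 1 : ℕ) : ℝ) - 1), sqIntegrand f I X h x :=
        setIntegral_nonneg measurableSet_Ioc fun y _ => sqIntegrand_nonneg f I X h y
      linarith
  have hhL : h ^ 2 ≤ (L : ℝ) ^ 2 := pow_le_pow_left₀ hh0.le (by rw [hhdef]; linarith) 2
  have hCB : 0 ≤ max C 0 * B' := mul_nonneg (le_max_right _ _) (hBpos.trans hBB')
  calc ∑ k ∈ Icc (⌈X⌉₊ + 1) ⌊2 * X⌋₊, ‖windowSumA2 f I X L k‖ ^ 2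
      = 2 * ∑ k ∈ Icc (⌈X⌉₊ + 1) ⌊2 * X⌋₊, 1 / 2 * ‖windowSumA2 f I X L k‖ ^ 2 := by
        rw [Finset.mul_sum]; refine Finset.sum_congr rfl fun k _ => by ring
    _ ≤ 2 * ∫ x in X..(2 * X), sqIntegrand f I X h x := by
        have := hsum.trans hsub
        linarith
    _ ≤ 2 * (max C 0 * B' * h ^ 2 * X) := by linarith [hint2]
    _ ≤ 2 * (max C 0 * B' * (L : ℝ) ^ 2 * X) := by
        have := mul_le_mul_of_nonneg_left hhL hCB
        nlinarith
    _ = 2 * max C 0 * B' * (L : ℝ) ^ 2 * X := by ring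

/-! ### The sequence of Definition 2.1 satisfies the standing assumptions of Appendix A -/

section Def21

variable {P₁ Q₁ : ℝ}

/-- Monotonicity of the Definition 2.1 intervals: `P_j ≤ Q_j ≤ P_{j+1}` for `j ≥ 1`, as soon as
`1 ≤ log P₁ ≤ log Q₁` ("the intervals `[P_j, Q_j]` are disjoint and increase to infinity").
[cite: MatomakiRadziwillTao2015, Definition 2.1] -/
theorem def21_mono (hP : 1 ≤ Real.log P₁) (hPQ : P₁ ≤ Q₁) (hP0 : 0 < P₁) {j : ℕ} (hj : 1 ≤ j) :
    seqP P₁ Q₁ j ≤ seqQ Q₁ j ∧ seqQ Q₁ j ≤ seqP P₁ Q₁ (j + 1) := by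
  have hlogPQ : Real.log P₁ ≤ Real.log Q₁ := Real.log_le_log hP0 hPQ
  have hQ1 : 1 ≤ Real.log Q₁ := hP.trans hlogPQ
  refine ⟨seqP_le_seqQ hj (by linarith) hlogPQ hPQ, ?_⟩
  have hj2 : 2 ≤ j + 1 := by omega
  rw [seqP_of_two_le hj2]
  rcases Nat.lt_or_ge j 2 with h | h
  · obtain rfl : j = 1 := by omega
    rw [seqQ_one]
    calc Q₁ = Real.exp (Real.log Q₁) := (Real.exp_log (by linarith)).symm
      _ ≤ _ := by
          refine Real.exp_le_exp.mpr ?_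
          norm_num
          nlinarith
  · rw [seqQ_of_two_le h]
    refine Real.exp_le_exp.mpr ?_
    have hj1 : (1 : ℝ) ≤ j := by exact_mod_cast (show 1 ≤ j by omega)
    have e1 : Real.log Q₁ ^ (j + 1 - 1) = Real.log Q₁ ^ j := by rw [Nat.add_sub_cancel]
    rw [e1]
    have h1 : (j : ℝ) ^ (4 * j + 2) ≤ ((j + 1 : ℕ) : ℝ) ^ (4 * (j + 1)) := by
      calc (j : ℝ) ^ (4 * j + 2) ≤ ((j + 1 : ℕ) : ℝ) ^ (4 * j + 2) :=
            pow_le_pow_left₀ (by positivity) (by push_cast; linarith) _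
        _ ≤ ((j + 1 : ℕ) : ℝ) ^ (4 * (j + 1)) :=
            pow_le_pow_right₀ (by push_cast; linarith) (by omega)
    have h2 : 0 ≤ Real.log Q₁ ^ j := by positivity
    calc (j : ℝ) ^ (4 * j + 2) * Real.log Q₁ ^ j = (j : ℝ) ^ (4 * j + 2) * Real.log Q₁ ^ j * 1 := by
          ring
      _ ≤ ((j + 1 : ℕ) : ℝ) ^ (4 * (j + 1)) * Real.log Q₁ ^ j * Real.log P₁ := by
          gcongr

/-- `log Q_{j-1} ≤ j^{4j-2} (log Q₁)^{j-1}` for `j ≥ 2` (`log Q₁ ≥ 0`). [cite: MatomakiRadziwillTao2015, Definition 2.1] -/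
theorem log_seqQ_pred_le (hQ : 0 ≤ Real.log Q₁) {j : ℕ} (hj : 2 ≤ j) :
    Real.log (seqQ Q₁ (j - 1)) ≤ (j : ℝ) ^ (4 * j - 2) * Real.log Q₁ ^ (j - 1) := by
  rcases Nat.lt_or_ge j 3 with h | h
  · obtain rfl : j = 2 := by omega
    norm_num [seqQ_one]
    nlinarith
  · have hj1 : 2 ≤ j - 1 := by omega
    rw [log_seqQ_of_two_le hj1]
    have e : 4 * (j - 1) + 2 = 4 * j - 2 := by omega
    rw [e]
    gcongr
    · exact_mod_cast Nat.sub_le j 1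

/-- **(A-2) for Definition 2.1**: `8 log Q_{j-1} + 16 log j ≤ (η/j²) log P_j` for all `j ≥ 2`, as
soon as `log Q₁ ≥ 1` and `η log P₁ ≥ 9`. [cite: MatomakiRadziwillTao2015, Appendix A ("can be verified to obey the above estimates")] -/
theorem def21_A2 {η : ℝ} (hη : 0 < η) (hQ : 1 ≤ Real.log Q₁) (hm : 9 ≤ η * Real.log P₁) {j : ℕ}
    (hj : 2 ≤ j) :
    8 * Real.log (seqQ Q₁ (j - 1)) + 16 * Real.log j ≤
      η / (j : ℝ) ^ 2 * Real.log (seqP P₁ Q₁ j) := by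
  rw [log_seqP_of_two_le hj]
  have hj2 : (2 : ℝ) ≤ j := by exact_mod_cast hj
  have hj0 : (0 : ℝ) < j := by linarith
  set A : ℝ := (j : ℝ) ^ (4 * j - 2) * Real.log Q₁ ^ (j - 1) with hA
  have hA1 : (64 : ℝ) ≤ (j : ℝ) ^ (4 * j - 2) := by
    calc (64 : ℝ) = 2 ^ 6 := by norm_num
      _ ≤ (j : ℝ) ^ 6 := pow_le_pow_left₀ (by norm_num) hj2 6
      _ ≤ (j : ℝ) ^ (4 * j - 2) := pow_le_pow_right₀ (by linarith) (by omega)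
  have hL1 : (1 : ℝ) ≤ Real.log Q₁ ^ (j - 1) := one_le_pow₀ hQ
  have hA64 : (j : ℝ) ^ (4 * j - 2) ≤ A := by
    rw [hA]; exact le_mul_of_one_le_right (by positivity) hL1
  -- `8 log Q_{j-1} ≤ 8 A`
  have h1 : Real.log (seqQ Q₁ (j - 1)) ≤ A := log_seqQ_pred_le (by linarith) hj
  -- `16 log j ≤ 16 j ≤ j^6 ≤ A`
  have h2 : 16 * Real.log j ≤ A := by
    have hlogj : Real.log j ≤ j := (Real.log_le_sub_one_of_pos hj0).trans (by linarith)
    have hj6 : 16 * (j : ℝ) ≤ (j : ℝ) ^ 6 := by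
      have : (16 : ℝ) ≤ (j : ℝ) ^ 5 := le_trans (by norm_num) (pow_le_pow_left₀ (by norm_num) hj2 5)
      nlinarith
    calc 16 * Real.log j ≤ 16 * j := by linarith
      _ ≤ (j : ℝ) ^ 6 := hj6
      _ ≤ (j : ℝ) ^ (4 * j - 2) := pow_le_pow_right₀ (by linarith) (by omega)
      _ ≤ A := hA64
  -- the right-hand side equals `η A log P₁`
  have e : η / (j : ℝ) ^ 2 * ((j : ℝ) ^ (4 * j) * Real.log Q₁ ^ (j - 1) * Real.log P₁) =
      η * A * Real.log P₁ := by
    rw [hA]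
    have : (j : ℝ) ^ (4 * j) = (j : ℝ) ^ (4 * j - 2) * (j : ℝ) ^ 2 := by
      rw [← pow_add]; congr 1; omega
    rw [this]
    field_simp
  rw [e]
  have hA0 : 0 ≤ A := by positivity
  nlinarith

set_option maxHeartbeats 400000 in
/-- **(A-1) for Definition 2.1**: `log log Q_j / (log P_{j-1} - 1) ≤ η/(4j²)` for all `j ≥ 2`,
as soon as `log Q₁ ≥ log P₁ ≥ 2^{21} + 1`, `η log P₁ ≥ 56` and `40 log log Q₁ ≤ η log P₁` (the
latter is `P₁ ≥ (log Q₁)^{40/η}`). [cite: MatomakiRadziwillTao2015, Appendix A ("can be verified to obey the above estimates")] -/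
theorem def21_A1 {η : ℝ} (hη : 0 < η) (hη' : η < 1 / 6) (hm0 : (2 : ℝ) ^ 21 + 1 ≤ Real.log P₁)
    (hPQ : Real.log P₁ ≤ Real.log Q₁) (hm : 56 ≤ η * Real.log P₁)
    (hm' : 40 * Real.log (Real.log Q₁) ≤ η * Real.log P₁) {j : ℕ} (hj : 2 ≤ j) :
    Real.log (Real.log (seqQ Q₁ j)) / (Real.log (seqP P₁ Q₁ (j - 1)) - 1) ≤
      η / (4 * (j : ℝ) ^ 2) := by
  set m := Real.log P₁ with hmdef
  set ℓ := Real.log Q₁ with hℓdef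
  have h221 : (2 : ℝ) ^ 21 + 1 ≤ m := hm0
  have hm1 : (2 : ℝ) ≤ m := le_trans (by norm_num) h221
  have hℓ1 : (2 : ℝ) ≤ ℓ := hm1.trans hPQ
  have hj2 : (2 : ℝ) ≤ j := by exact_mod_cast hj
  have hj0 : (0 : ℝ) < j := by linarith
  -- `log log Q_j = (4j+2) log j + j log ℓ`
  have hlogQj : Real.log (seqQ Q₁ j) = (j : ℝ) ^ (4 * j + 2) * ℓ ^ j := log_seqQ_of_two_le hj
  have hpos : 0 < (j : ℝ) ^ (4 * j + 2) * ℓ ^ j := by positivity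
  have hloglog : Real.log (Real.log (seqQ Q₁ j)) = (4 * j + 2) * Real.log j + j * Real.log ℓ := by
    rw [hlogQj, Real.log_mul (by positivity) (by positivity), Real.log_pow, Real.log_pow]
    push_cast; ring
  have hlogj : Real.log j ≤ j := (Real.log_le_sub_one_of_pos hj0).trans (by linarith)
  have hlogℓ : Real.log ℓ ≤ ℓ := (Real.log_le_sub_one_of_pos (by linarith)).trans (by linarith)
  have hlogℓ0 : 0 ≤ Real.log ℓ := Real.log_nonneg (by linarith)
  rcases Nat.lt_or_ge j 3 with h3 | h3
  · -- `j = 2`: denominator `m - 1`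
    obtain rfl : j = 2 := by omega
    have e : seqP P₁ Q₁ (2 - 1) = P₁ := by norm_num [seqP_one]
    have hden : 0 < m - 1 := by linarith
    rw [e, ← hmdef, div_le_div_iff₀ hden (by positivity), hloglog]
    push_cast
    -- `16 (10 log 2 + 2 log ℓ) ≤ η (m - 1)`
    have hℓbig : 21 * Real.log 2 ≤ Real.log ℓ := by
      have : (2 : ℝ) ^ 21 ≤ ℓ := by linarith
      calc 21 * Real.log 2 = Real.log ((2 : ℝ) ^ 21) := by rw [Real.log_pow]; push_cast; ring
        _ ≤ Real.log ℓ := Real.log_le_log (by positivity) this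
    have hlog2 := Real.log_two_gt_d9
    have e2 : η * (m - 1) = η * m - η := by ring
    rw [e2]
    nlinarith
  · -- `j ≥ 3`: denominator `log P_{j-1} - 1` with `j - 1 ≥ 2`
    have hj1 : 2 ≤ j - 1 := by omega
    have hlogP : Real.log (seqP P₁ Q₁ (j - 1)) = ((j - 1 : ℕ) : ℝ) ^ (4 * (j - 1)) * ℓ ^ (j - 1 - 1) * m :=
      log_seqP_of_two_le hj1
    -- `(j-1)^{4(j-1)} ≥ j^4`
    have hnat : j ^ 4 ≤ (j - 1) ^ (4 * (j - 1)) := by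
      obtain ⟨k, rfl⟩ : ∃ k, j = k + 1 := ⟨j - 1, by omega⟩
      rw [Nat.add_sub_cancel]
      have hk : 2 ≤ k := by omega
      have h1 : k + 1 ≤ k ^ 2 := by nlinarith
      calc (k + 1) ^ 4 ≤ (k ^ 2) ^ 4 := Nat.pow_le_pow_left h1 4
        _ = k ^ 8 := by rw [← pow_mul]
        _ ≤ k ^ (4 * k) := Nat.pow_le_pow_right (by omega) (by omega)
    have hreal : (j : ℝ) ^ 4 ≤ ((j - 1 : ℕ) : ℝ) ^ (4 * (j - 1)) := by exact_mod_cast hnat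
    have hℓpow : ℓ ≤ ℓ ^ (j - 1 - 1) := by
      calc ℓ = ℓ ^ 1 := (pow_one ℓ).symm
        _ ≤ ℓ ^ (j - 1 - 1) := pow_le_pow_right₀ (by linarith) (by omega)
    have hD : (j : ℝ) ^ 4 * ℓ * m ≤ Real.log (seqP P₁ Q₁ (j - 1)) := by
      rw [hlogP]
      have : (j : ℝ) ^ 4 * ℓ ≤ ((j - 1 : ℕ) : ℝ) ^ (4 * (j - 1)) * ℓ ^ (j - 1 - 1) :=
        mul_le_mul hreal hℓpow (by linarith) (by positivity)
      exact mul_le_mul_of_nonneg_right this (by linarith)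
    have hj4 : (16 : ℝ) ≤ (j : ℝ) ^ 4 := le_trans (by norm_num) (pow_le_pow_left₀ (by norm_num) hj2 4)
    have hJ : (64 : ℝ) ≤ (j : ℝ) ^ 4 * ℓ * m := by
      have h1 : (16 : ℝ) * 2 ≤ (j : ℝ) ^ 4 * ℓ := mul_le_mul hj4 hℓ1 (by norm_num) (by positivity)
      have h2 : (16 : ℝ) * 2 * 2 ≤ (j : ℝ) ^ 4 * ℓ * m := mul_le_mul h1 hm1 (by norm_num) (by positivity)
      linarith
    have hden : 0 < Real.log (seqP P₁ Q₁ (j - 1)) - 1 := by linarith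
    rw [div_le_div_iff₀ hden (by positivity), hloglog]
    -- `LHS ≤ 7 j² ℓ · 4j² = 28 j⁴ ℓ` and `RHS ≥ η (j⁴ ℓ m - 1)`
    have hjj : (j : ℝ) ≤ (j : ℝ) ^ 2 := by nlinarith
    have hL : ((4 * (j : ℝ) + 2) * Real.log j + j * Real.log ℓ) ≤ 7 * (j : ℝ) ^ 2 * ℓ := by
      have h1 : (4 * (j : ℝ) + 2) * Real.log j ≤ 6 * (j : ℝ) ^ 2 := by nlinarith
      have h2 : (j : ℝ) * Real.log ℓ ≤ (j : ℝ) ^ 2 * ℓ :=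
        mul_le_mul hjj hlogℓ hlogℓ0 (by positivity)
      have h3 : 0 ≤ (j : ℝ) ^ 2 * ℓ := by positivity
      nlinarith
    have hjpos : 0 < (j : ℝ) ^ 2 := by positivity
    have k1 : ((4 * (j : ℝ) + 2) * Real.log j + j * Real.log ℓ) * (4 * (j : ℝ) ^ 2) ≤
        28 * ((j : ℝ) ^ 4 * ℓ) := by
      have := mul_le_mul_of_nonneg_right hL (le_of_lt (by positivity : (0 : ℝ) < 4 * (j : ℝ) ^ 2))
      nlinarith
    have k2 : 56 * ((j : ℝ) ^ 4 * ℓ) ≤ η * ((j : ℝ) ^ 4 * ℓ * m) := by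
      have := mul_le_mul_of_nonneg_left hm (show 0 ≤ (j : ℝ) ^ 4 * ℓ by positivity)
      nlinarith
    have k3 : η * ((j : ℝ) ^ 4 * ℓ * m) ≤ η * Real.log (seqP P₁ Q₁ (j - 1)) :=
      mul_le_mul_of_nonneg_left hD hη.le
    have k4 : (0 : ℝ) ≤ (j : ℝ) ^ 4 * ℓ := by positivity
    nlinarith

/-- **The sequence of Definition 2.1 is an interval system in the sense of Appendix A**
(monotone intervals of positive reals with `P₁ ≥ 1`, (A-1), (A-2), and a cutoff `J ≥ 1` = the
largest `j` with `Q_j ≤ exp(√(log X₀))`) for a given `η ∈ (0, 1/6)`, provided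
`exp(√(log X₀)) ≥ Q₁ ≥ P₁ ≥ (log Q₁)^{40/η}` and `P₁ ≥ P₀(η)` ("For example, given `0 < η < 1/6`,
the sequence of intervals `[P_j, Q_j]` defined in Definition 2.1 can be verified to obey the above
estimates if `exp(√(log X₀)) ≥ Q₁ ≥ P₁ ≥ (log Q₁)^{40/η}` and if `P₁` is sufficiently large").
The system is produced as a `Parity.SieveIntervalSystem η X₀` whose endpoint sequences ARE
`seqP P₁ Q₁`, `seqQ Q₁` (so that `mem_iff_isTypical` applies); `J` exists because
`log Q_j ≥ j → ∞`. [cite: MatomakiRadziwillTao2015, Appendix A] -/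
theorem def21_system {η : ℝ} (hη : 0 < η) (hη' : η < 1 / 6) :
    ∃ P₀ : ℝ, ∀ P₁ Q₁ X₀ : ℝ, P₀ ≤ P₁ → P₁ ≤ Q₁ → Real.log Q₁ ^ (40 / η) ≤ P₁ →
      Q₁ ≤ Real.exp (Real.sqrt (Real.log X₀)) →
      ∃ I : SieveIntervalSystem η X₀, I.P = seqP P₁ Q₁ ∧ I.Q = seqQ Q₁ := by
  refine ⟨Real.exp (max ((2 : ℝ) ^ 21 + 1) (56 / η)), ?_⟩
  intro P₁ Q₁ X₀ hP₀ hPQ hpow hQE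
  set m := Real.log P₁ with hmdef
  have hP0 : 0 < P₁ := (Real.exp_pos _).trans_le hP₀
  have hm : max ((2 : ℝ) ^ 21 + 1) (56 / η) ≤ m := by
    have := Real.log_le_log (Real.exp_pos _) hP₀
    rwa [Real.log_exp] at this
  have hm0 : (2 : ℝ) ^ 21 + 1 ≤ m := (le_max_left _ _).trans hm
  have hm56 : 56 ≤ η * m := by
    have := (le_max_right _ _).trans hm
    rw [div_le_iff₀ hη] at this; linarith
  have hm1 : 1 ≤ m := le_trans (by norm_num) hm0
  have hP1 : 1 ≤ P₁ := by
    have : Real.exp 0 ≤ P₁ := le_trans (Real.exp_le_exp.mpr (le_trans (by positivity) (le_max_left _ _))) hP₀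
    simpa using this
  have hP1' : 1 < P₁ := by
    have h2 : Real.exp 1 ≤ P₁ := by
      calc Real.exp 1 ≤ Real.exp m := Real.exp_le_exp.mpr hm1
        _ = P₁ := Real.exp_log hP0
    have h3 : (1 : ℝ) < Real.exp 1 := by linarith [Real.add_one_lt_exp (by norm_num : (1:ℝ) ≠ 0)]
    linarith
  have hlogPQ : m ≤ Real.log Q₁ := Real.log_le_log hP0 hPQ
  have hQ1 : 1 ≤ Real.log Q₁ := hm1.trans hlogPQ
  have hℓ0 : 0 < Real.log Q₁ := by linarith
  have hQ0 : 0 < Q₁ := hP0.trans_le hPQ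
  have hm' : 40 * Real.log (Real.log Q₁) ≤ η * m := by
    have h1 := Real.log_le_log (Real.rpow_pos_of_pos hℓ0 _) hpow
    rw [Real.log_rpow hℓ0] at h1
    rw [div_mul_eq_mul_div, div_le_iff₀ hη] at h1
    linarith
  -- the cutoff `J`: the least `j` with `exp(√(log X₀)) < Q_{j+1}`
  set E := Real.exp (Real.sqrt (Real.log X₀)) with hE
  have hex : ∃ j : ℕ, E < seqQ Q₁ (j + 1) := by
    refine ⟨⌈Real.sqrt (Real.log X₀)⌉₊, ?_⟩
    have h1 : ((⌈Real.sqrt (Real.log X₀)⌉₊ + 1 : ℕ) : ℝ) ≤ Real.log (seqQ Q₁ (⌈Real.sqrt (Real.log X₀)⌉₊ + 1)) :=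
      le_log_seqQ (by omega) hQ1
    have h2 : Real.sqrt (Real.log X₀) < ((⌈Real.sqrt (Real.log X₀)⌉₊ + 1 : ℕ) : ℝ) := by
      push_cast; linarith [Nat.le_ceil (Real.sqrt (Real.log X₀))]
    calc E = Real.exp (Real.sqrt (Real.log X₀)) := hE
      _ < Real.exp (Real.log (seqQ Q₁ (⌈Real.sqrt (Real.log X₀)⌉₊ + 1))) := Real.exp_lt_exp.mpr (by linarith)
      _ = seqQ Q₁ (⌈Real.sqrt (Real.log X₀)⌉₊ + 1) := Real.exp_log (seqQ_pos hQ0 _)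
  classical
  let J := Nat.find hex
  have hJspec : E < seqQ Q₁ (J + 1) := Nat.find_spec hex
  have hJ1 : 1 ≤ J := by
    by_contra h0
    have hJ0 : J = 0 := by omega
    have := hJspec
    rw [hJ0, zero_add, seqQ_one] at this
    linarith
  have hJle : seqQ Q₁ J ≤ E := by
    have := Nat.find_min hex (m := J - 1) (by omega)
    rw [Nat.sub_add_cancel hJ1] at this
    exact not_lt.mp this
  refine ⟨{ P := seqP P₁ Q₁, Q := seqQ Q₁, J := J,
            pos_P := fun j _ => seqP_pos hP0 j,
            one_le_P_one := by rw [seqP_one]; exact hP1,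
            P_le_Q := fun j hj => (def21_mono hm1 hPQ hP0 hj).1,
            notTooFar := ?_,
            notTooClose := fun j hj => def21_A2 hη hQ1 (by linarith) hj,
            one_le_J := hJ1, Q_J_le := hJle, lt_Q_succ := hJspec }, rfl, rfl⟩
  intro j hj
  have hq := def21_A1 hη hη' hm0 hlogPQ hm56 hm' hj
  -- the denominator `log P_{j-1} - 1` is positive (`P_{j-1} ≥ P₁ ≥ e^{2^21+1}`)
  have hden : 0 < Real.log (seqP P₁ Q₁ (j - 1)) - 1 := by
    have h1 : P₁ ≤ seqP P₁ Q₁ (j - 1) := le_seqP hP1' hQ1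
    have h2 : m ≤ Real.log (seqP P₁ Q₁ (j - 1)) := Real.log_le_log hP0 h1
    linarith
  rwa [div_le_iff₀ hden] at hq

end Def21

/-! ### Bridges: `I.Mem` versus typical factorization -/

/-- For an interval system `I` (`0 < η ≤ 8`, so that the `Q_j` increase) and `n ≠ 0`:
`n ∈ I.Mem` (a prime factor in `[P_j, Q_j]` for each `1 ≤ j ≤ J`) iff `n` has a prime factor in
each `[P_j, Q_j]` with `j ≥ 1` and `Q_j ≤ exp(√(log X₀))` — "`J` is chosen to be the largest index
`j` such that `Q_j ≤ exp((log X₀)^{1/2})`". [cite: MatomakiRadziwillTao2015, Appendix A] -/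
theorem mem_iff_forall_hasFactorIn (I : SieveIntervalSystem η X₀) (hη : 0 < η) (hη' : η ≤ 8)
    {n : ℕ} (hn : n ≠ 0) :
    I.Mem n ↔ ∀ j : ℕ, 1 ≤ j → I.Q j ≤ Real.exp (Real.sqrt (Real.log X₀)) →
      HasFactorIn n (I.P j) (I.Q j) := by
  constructor
  · intro h j hj hQ
    obtain ⟨p, hp, h1, h2⟩ := h j (Finset.mem_Icc.mpr ⟨hj, I.le_J_of_Q_le hη hη' hQ⟩)
    exact ⟨p, Nat.prime_of_mem_primeFactors hp, Nat.dvd_of_mem_primeFactors hp, h1, h2⟩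
  · intro h j hj
    rw [Finset.mem_Icc] at hj
    have hQ : I.Q j ≤ Real.exp (Real.sqrt (Real.log X₀)) := by
      rcases eq_or_lt_of_le hj.2 with h' | h'
      · rw [h']; exact I.Q_J_le
      · exact (I.Q_lt_Q hη hη' hj.1 h').le.trans I.Q_J_le
    obtain ⟨p, hp, hpn, h1, h2⟩ := h j hj.1 hQ
    exact ⟨p, Nat.mem_primeFactors.mpr ⟨hp, hpn, hn⟩, h1, h2⟩

/-- For an interval system whose endpoints are those of Definition 2.1 (`def21_system`) and
`n ≠ 0`: `n ∈ I.Mem ↔ IsTypical P₁ Q₁ X₀ n`. [cite: MatomakiRadziwillTao2015, Definition 2.1] -/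
theorem mem_iff_isTypical {P₁ Q₁ : ℝ} (I : SieveIntervalSystem η X₀) (hη : 0 < η) (hη' : η ≤ 8)
    (hP : I.P = seqP P₁ Q₁) (hQ : I.Q = seqQ Q₁) {n : ℕ} (hn : n ≠ 0) :
    I.Mem n ↔ IsTypical P₁ Q₁ X₀ n := by
  rw [mem_iff_forall_hasFactorIn I hη hη' hn, IsTypical, hP, hQ]

end MRT2015

end Literature.NumberTheory.LFunctions
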